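import Mathlib.Algebra.Module.ZLattice.Basic
import Mathlib.MeasureTheory.Group.FundamentalDomain
import Mathlib.Analysis.InnerProductSpace.Laplacian
import Mathlib.Analysis.Calculus.Gradient.Basic
import Literature.Analysis.FunctionSpaces.FlatTorusProofs
import Literature.Analysis.FunctionSpaces.TorusCalculus
import HarnessLib

/-!
# Periodisation along `ℤ^d` and unfolding of integrals between `ℝ^d` and the flat torus `T^d`

Analysis/FunctionSpaces support file for the torus glue of `FlatTorus` / `TorusCalculus`
(trunk: Sobolev, notion `flat_torus_T3`). It provides the two standard devices relating
analysis on `T^d = ℝ^d/ℤ^d` to analysis on `ℝ^d` (Grafakos, *Classical Fourier Analysis*,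
§3.1.1; Stein–Weiss, *Introduction to Fourier Analysis on Euclidean Spaces*, Ch. VII §2):

* **tiling / unfolding**: the unit cube `[0,1)^d` (`Torus.unitCube`) is a fundamental domain of
  the lattice `ℤ^d` (`Torus.isAddFundamentalDomain_unitCube`, via Mathlib's
  `ZSpan.isAddFundamentalDomain`), whence `∑_{k ∈ ℤ^d} ∫_{[0,1)^d} F(y + k) dy = ∫_{ℝ^d} F`
  (`Torus.tsum_lintegral_unitCube_add_latticeVec`, `Torus.integral_eq_tsum_setIntegral_unitCube`)
  and, for an integrable `g` with bounded support,
  `∫_{ℝ^d} g = ∫_{[0,1)^d} ∑ₖ g(· + k) = ∫_{T^d} (periodize g)`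
  (`Torus.integral_eq_setIntegral_unitCube_perSum`, `Torus.integral_eq_integral_perSum_repr`);
* **periodisation**: `Torus.perSum g (y) = ∑_{k ∈ ℤ^d} g (y + k)` on `ℝ^d` (a `tsum`, pointwise
  a finite sum over a lattice window when `g` has bounded support, `Torus.perSum_eq_sum`) and
  its descent `Torus.periodize g : T^d → F`, `x ↦ perSum g (repr x)`, with
  `lift (periodize g) = perSum g` (`Torus.lift_periodize`). For `g ∈ C_c^n(ℝ^d)` the
  periodisation is `C^n` (`Torus.contDiff_perSum`, `Torus.isSmooth_periodize`) and
  derivatives commute with it: `D`, `Δ`, `∇` (`Torus.fderiv_perSum`, `Torus.laplacian_perSum`,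
  `Torus.gradient_perSum`, and the torus forms `Torus.fderiv_periodize`,
  `Torus.laplacian_periodize`, `Torus.gradient_periodize`), as well as `∂ₜ` for space–time
  fields periodised in the space variable (`Torus.contDiff_uncurry_perSum`,
  `Torus.deriv_perSum`, `Torus.stLift_periodize`, `Torus.timeDeriv_periodize`);
* **local integrability of lifts**: for `H` on `T^d`, `∫_B H ∘ proj ≤ #window · ∫_{T^d} H`
  for bounded `B` (`Torus.setLIntegral_lift_le`), `H ∈ L¹(T^d) ⇒ H ∘ proj ∈ L¹_loc(ℝ^d)`
  (`Torus.integrableOn_lift_of_subset_closedBall`, `Torus.locallyIntegrable_lift`).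

It serves the torus-to-space bridge for weak Navier–Stokes solutions
(`Literature.Analysis.FluidPDE.WeakSolutionLift`): a compactly supported test field on
`ℝ^d` is paired with a periodic field exactly as its periodisation is paired on `T^d`.

## Main definitions

* `Torus.stdLattice d`, `Torus.stdLatticeEquiv d` — the lattice `ℤ^d ⊂ ℝ^d` as the `ℤ`-span of
  the standard basis, parametrised by `Torus.latticeVec`;
* `Torus.latticeWindow d n` — the finite window `{k : |kᵢ| ≤ n}`;
* `Torus.perSum g`, `Torus.periodize g`.

## Mathlib

Used: `ZSpan.fundamentalDomain`/`ZSpan.isAddFundamentalDomain'` and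
`IsAddFundamentalDomain.lintegral_eq_tsum''`/`integral_eq_tsum''` (tiling),
`measurePreserving_sub_right`, `lintegral_map'`, `MeasurePreserving.integrable_comp`,
`InnerProductSpace.laplacian` congruence/additivity lemmas, `iteratedFDeriv_comp_add_right`.
Mathlib has no periodisation operator on `ℝ^d` (searched `periodiz`: only
`periodizedBernoulli` on the circle; the Poisson summation file `Analysis/Fourier/PoissonSummation`
is one-dimensional, `∑' n : ℤ, f (x + n)`). In the tree, the same namespace already has the
*small-support* periodisation `Literature.Torus.transplant ρ z = ρ (reprc z)` (`TorusMollifier`): for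
`ρ` supported in `B(0, 1/4)` it is the lattice sum `∑ₖ ρ(y + k)` read on the torus (at most one
non-zero term); `Torus.periodize` below is its generalisation to arbitrary (boundedly supported)
`g`, with the full lattice sum (twin, not imported here to keep the import graph light: the two
agree, `periodize ρ = transplant ρ`, whenever `tsupport ρ ⊆ B(0, 1/4)`). Other layers have ad
hoc lattice sums tied to their own conventions (`BoseGas.latSum` on `ℝ³` with lattice `Lℤ³`,
`AQFT.perExt`); `NumberTheory/LFunctions/DedekindZetaMellinProofs` has the tiling identity
`lintegral_eq_tsum_lintegral_unitCube_add_intCast` on the `Pi` carrier `d → ℝ` (twin of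
`tsum_lintegral_unitCube_add_latticeVec` below, which is stated on `EuclideanSpace ℝ d`), and
`TorusSpaceTimeLift` has the space–time forms `measurePreserving_proj_translate`,
`locallyIntegrable_stLift` of the local-integrability lemmas below.

## References

* L. Grafakos, *Classical Fourier Analysis*, 3rd ed. (2014), §3.1.1 (`Tⁿ = ℝⁿ/ℤⁿ`, the
  fundamental domain `[0,1)ⁿ`, `1`-periodic functions, periodisation of functions on `ℝⁿ`).
* E. M. Stein, G. Weiss, *Introduction to Fourier Analysis on Euclidean Spaces* (1971),
  Ch. VII §1 (the unit lattice `Λ`, `Eₙ/Λ`, periodic functions), §2 (2.1) (periodisation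
  `f ↦ ∑_{m ∈ Λ} f(x + m)`, book p. 251) and Thm. 2.4 (for `f ∈ L¹(Eₙ)` the periodisation
  converges in `L¹(Qₙ)`; `∫_{Qₙ} ∑_m f(x + m) dx = ∫_{Eₙ} f`, book p. 252).
-/

noncomputable section

open MeasureTheory Measure Set Function Filter Topology Metric
open scoped ContDiff InnerProductSpace Laplacian Pointwise

namespace Literature.Analysis.FunctionSpaces

namespace Torus

variable {d : Type*} [Fintype d]
variable {F : Type*}

/-! ## The unit cube is a fundamental domain of `ℤ^d`; tiling identities -/

section Tiling

/-- The unit cube `[0,1)^d` is the `ZSpan` fundamental domain of the standard basis of `ℝ^d`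
(Grafakos, §3.1.1). [folklore] -/
theorem unitCube_eq_fundamentalDomain :
    unitCube d = ZSpan.fundamentalDomain (EuclideanSpace.basisFun d ℝ).toBasis := by
  ext x
  simp [ZSpan.mem_fundamentalDomain, unitCube]

/-- The standard lattice `ℤ^d = span_ℤ {eᵢ} ⊂ ℝ^d` as an additive subgroup. [folklore] -/
abbrev stdLattice (d : Type*) [Fintype d] : AddSubgroup (EuclideanSpace ℝ d) :=
  (Submodule.span ℤ (Set.range (EuclideanSpace.basisFun d ℝ).toBasis)).toAddSubgroup

/-- The unit cube is an additive fundamental domain for the action of `ℤ^d` on `ℝ^d` by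
translations, for Lebesgue measure (Mathlib `ZSpan.isAddFundamentalDomain'`). [folklore] -/
theorem isAddFundamentalDomain_unitCube :
    IsAddFundamentalDomain (stdLattice d) (unitCube d) (volume : Measure (EuclideanSpace ℝ d)) := by
  rw [unitCube_eq_fundamentalDomain]
  exact ZSpan.isAddFundamentalDomain' _ _

/-- The standard lattice is countable (it is a finitely generated free `ℤ`-module). [folklore] -/
theorem countable_stdLattice : Countable (stdLattice d) := by
  change Countable (Submodule.span ℤ (Set.range (EuclideanSpace.basisFun d ℝ).toBasis))
  infer_instance

/-- The parametrisation `k ↦ ∑ⱼ kⱼ eⱼ` of the standard lattice by `ℤ^d`. [folklore] -/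
def stdLatticeEquiv (d : Type*) [Fintype d] : (d → ℤ) ≃ stdLattice d :=
  (((EuclideanSpace.basisFun d ℝ).toBasis.restrictScalars ℤ).equivFun.symm.toEquiv)

/-- The parametrisation of the standard lattice is `latticeVec`. [folklore] -/
@[simp]
theorem coe_stdLatticeEquiv [DecidableEq d] (k : d → ℤ) :
    ((stdLatticeEquiv d k : stdLattice d) : EuclideanSpace ℝ d) = latticeVec k := by
  simp only [stdLatticeEquiv, LinearEquiv.coe_toEquiv, Module.Basis.equivFun_symm_apply,
    Submodule.coe_sum, Submodule.coe_smul_of_tower, Module.Basis.restrictScalars_apply]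
  ext i
  rw [latticeVec_apply, WithLp.ofLp_sum, Finset.sum_apply,
    Finset.sum_eq_single i (fun j _ hj => by simp [hj]) (by simp)]
  simp

variable [DecidableEq d]

/-- **Tiling, Lebesgue version.** `∑_{k ∈ ℤ^d} ∫_{[0,1)^d} F(y + k) dy = ∫_{ℝ^d} F` for every
`F ≥ 0` (no measurability needed): the translates of the unit cube tile `ℝ^d`
(Grafakos, §3.1.1). Twin (on the `Pi` carrier `d → ℝ`, lattice `ℤ^d` via `Int.cast`) of
`lintegral_eq_tsum_lintegral_unitCube_add_intCast` in
`NumberTheory/LFunctions/DedekindZetaMellinProofs` (other layer, not importable here). [folklore] -/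
theorem tsum_lintegral_unitCube_add_latticeVec (F : EuclideanSpace ℝ d → ENNReal) :
    ∑' k : d → ℤ, ∫⁻ y in unitCube d, F (y + latticeVec k) = ∫⁻ y, F y := by
  haveI := countable_stdLattice (d := d)
  rw [(isAddFundamentalDomain_unitCube (d := d)).lintegral_eq_tsum'' F,
    ← (stdLatticeEquiv d).tsum_eq]
  refine tsum_congr fun k => lintegral_congr fun y => ?_
  rw [AddSubgroup.vadd_def, vadd_eq_add, coe_stdLatticeEquiv, add_comm]

/-- **Tiling, Bochner version.** `∫_{ℝ^d} g = ∑_{k ∈ ℤ^d} ∫_{[0,1)^d} g(y + k) dy` for integrable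
`g` (Grafakos, §3.1.1). [folklore] -/
theorem integral_eq_tsum_setIntegral_unitCube [NormedAddCommGroup F] [NormedSpace ℝ F]
    {g : EuclideanSpace ℝ d → F} (hg : Integrable g volume) :
    ∫ y, g y = ∑' k : d → ℤ, ∫ y in unitCube d, g (y + latticeVec k) := by
  haveI := countable_stdLattice (d := d)
  rw [(isAddFundamentalDomain_unitCube (d := d)).integral_eq_tsum'' g hg,
    ← (stdLatticeEquiv d).tsum_eq]
  refine tsum_congr fun k => setIntegral_congr_fun measurableSet_unitCube fun y _ => ?_
  rw [AddSubgroup.vadd_def, vadd_eq_add, coe_stdLatticeEquiv, add_comm]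

end Tiling

/-! ## Finite lattice windows -/

section Window

variable [DecidableEq d]

/-- The finite window `{k ∈ ℤ^d : |kᵢ| ≤ n for all i}` of lattice points. [folklore] -/
def latticeWindow (d : Type*) [Fintype d] [DecidableEq d] (n : ℕ) : Finset (d → ℤ) :=
  Fintype.piFinset fun _ => Finset.Icc (-(n : ℤ)) n

/-- Membership in the lattice window. [folklore] -/
theorem mem_latticeWindow {n : ℕ} {k : d → ℤ} :
    k ∈ latticeWindow d n ↔ ∀ i, -(n : ℤ) ≤ k i ∧ k i ≤ n := by
  simp [latticeWindow, Fintype.mem_piFinset]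

/-- The coordinates of a lattice vector are bounded by its norm: `|kᵢ| ≤ ‖∑ⱼ kⱼ eⱼ‖`. [folklore] -/
theorem abs_le_norm_latticeVec (k : d → ℤ) (i : d) : |(k i : ℝ)| ≤ ‖latticeVec k‖ := by
  have h := PiLp.norm_apply_le (latticeVec k) i
  rwa [latticeVec_apply, Real.norm_eq_abs] at h

/-- `latticeVec (-k) = -latticeVec k`. [folklore] -/
theorem latticeVec_neg (k : d → ℤ) : latticeVec (-k) = -latticeVec k := by
  ext i
  simp

/-- A lattice vector of norm `≤ n` lies in the window of size `n`. [folklore] -/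
theorem mem_latticeWindow_of_norm_le {n : ℕ} {k : d → ℤ} (h : ‖latticeVec k‖ ≤ n) :
    k ∈ latticeWindow d n := by
  refine mem_latticeWindow.2 fun i => ?_
  have hi : |(k i : ℝ)| ≤ n := (abs_le_norm_latticeVec k i).trans h
  rw [abs_le] at hi
  exact ⟨by exact_mod_cast hi.1, by exact_mod_cast hi.2⟩

/-- If `g` is supported in the closed ball of radius `R` and `‖y‖ ≤ r`, then every lattice
translate `g (y + k)` with `k` outside the window of size `n ≥ R + r` vanishes. [folklore] -/
theorem apply_add_latticeVec_eq_zero {F : Type*} [Zero F] {g : EuclideanSpace ℝ d → F}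
    {R r : ℝ} (hg : support g ⊆ closedBall 0 R) {y : EuclideanSpace ℝ d} (hy : ‖y‖ ≤ r) {n : ℕ}
    (hn : R + r ≤ n) {k : d → ℤ} (hk : k ∉ latticeWindow d n) : g (y + latticeVec k) = 0 := by
  by_contra h
  have h1 : ‖y + latticeVec k‖ ≤ R := by simpa using hg (mem_support.2 h)
  have h2 : ‖latticeVec k‖ ≤ n := by
    have h3 : ‖latticeVec k‖ ≤ ‖y + latticeVec k‖ + ‖y‖ := by
      simpa using norm_sub_le (y + latticeVec k) y
    linarith
  exact hk (mem_latticeWindow_of_norm_le h2)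

/-- Points of the unit cube have norm at most `card d` (each coordinate lies in `[0,1)`).
[folklore] -/
theorem norm_le_card_of_mem_unitCube {y : EuclideanSpace ℝ d} (hy : y ∈ unitCube d) :
    ‖y‖ ≤ Fintype.card d := by
  have h := (EuclideanSpace.basisFun d ℝ).sum_repr y
  simp only [EuclideanSpace.basisFun_repr, EuclideanSpace.basisFun_apply] at h
  calc ‖y‖ = ‖∑ i, y i • EuclideanSpace.single i (1 : ℝ)‖ := by rw [h]
    _ ≤ ∑ i, ‖y i • EuclideanSpace.single i (1 : ℝ)‖ := norm_sum_le _ _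
    _ ≤ ∑ _i : d, (1 : ℝ) := Finset.sum_le_sum fun i _ => by
        rw [norm_smul, EuclideanSpace.single, PiLp.norm_single, norm_one, mul_one, Real.norm_eq_abs,
          abs_of_nonneg (hy i).1]
        exact (hy i).2.le
    _ = Fintype.card d := by simp

/-- Every point of the closed ball of radius `r` lies in a translate `k + [0,1)^d` of the unit
cube with `k` in the window of size `n ≥ r + 1` (take `kᵢ = ⌊yᵢ⌋`). [folklore] -/
theorem exists_mem_latticeWindow_sub_mem_unitCube {r : ℝ} {n : ℕ} (hn : r + 1 ≤ n)
    {y : EuclideanSpace ℝ d} (hy : ‖y‖ ≤ r) :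
    ∃ k ∈ latticeWindow d n, y - latticeVec k ∈ unitCube d := by
  refine ⟨fun i => ⌊y i⌋, mem_latticeWindow.2 fun i => ?_, fun i => ?_⟩
  · have hi : |y i| ≤ r := by
      have := PiLp.norm_apply_le y i
      rw [Real.norm_eq_abs] at this
      exact this.trans hy
    rw [abs_le] at hi
    have h1 : (⌊y i⌋ : ℝ) ≤ y i := Int.floor_le _
    have h2 : y i < ⌊y i⌋ + 1 := Int.lt_floor_add_one _
    constructor
    · have : (-(n : ℝ)) < (⌊y i⌋ : ℝ) + 1 := by linarith
      have : (-(n : ℤ) : ℝ) ≤ ((⌊y i⌋ : ℤ) : ℝ) := by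
        have h' : (-(n : ℤ) : ℤ) < ⌊y i⌋ + 1 := by exact_mod_cast this
        exact_mod_cast (Int.lt_add_one_iff.1 h')
      exact_mod_cast this
    · have : ((⌊y i⌋ : ℤ) : ℝ) ≤ (n : ℝ) := by linarith
      exact_mod_cast this
  · simp only [PiLp.sub_apply, latticeVec_apply, mem_Ico]
    exact ⟨sub_nonneg.2 (Int.floor_le _), by linarith [Int.lt_floor_add_one (y i)]⟩

/-- The closed ball of radius `r` is covered by the window translates of the unit cube.
[folklore] -/
theorem closedBall_subset_biUnion_latticeWindow {r : ℝ} {n : ℕ} (hn : r + 1 ≤ n) :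
    closedBall (0 : EuclideanSpace ℝ d) r ⊆
      ⋃ k ∈ latticeWindow d n, (fun y => y - latticeVec k) ⁻¹' unitCube d := by
  intro y hy
  obtain ⟨k, hk, hyk⟩ := exists_mem_latticeWindow_sub_mem_unitCube hn (mem_closedBall_zero_iff.1 hy)
  exact mem_biUnion hk hyk

end Window

/-! ## Periodisation -/

section PerSum

variable [DecidableEq d]

/-- The **periodisation** `perSum g (y) = ∑_{k ∈ ℤ^d} g (y + k)` of a function on `ℝ^d` along the
unit lattice `ℤ^d` (Stein–Weiss, *Introduction to Fourier Analysis on Euclidean Spaces*,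
Ch. VII §2, (2.1): "the passage from `f` to the sum `∑_{m ∈ Λ} f(x + m)` [is] the
*periodization* of `f`"; Grafakos, §3.1.1). Defined as a `tsum`; for `g` with bounded support
the sum is finite at every point (`perSum_eq_sum`). Junk value: `0` at points where the family
is not summable. [cite: SteinWeiss1971, Ch. VII §2 (2.1)] -/
def perSum [AddCommMonoid F] [TopologicalSpace F] (g : EuclideanSpace ℝ d → F)
    (y : EuclideanSpace ℝ d) : F :=
  ∑' k : d → ℤ, g (y + latticeVec k)

variable [AddCommMonoid F] [TopologicalSpace F]

/-- Unfolding `perSum`. [folklore] -/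
theorem perSum_apply (g : EuclideanSpace ℝ d → F) (y : EuclideanSpace ℝ d) :
    perSum g y = ∑' k : d → ℤ, g (y + latticeVec k) :=
  rfl

/-- The periodisation of the zero function is zero. [folklore] -/
@[simp]
theorem perSum_zero : perSum (0 : EuclideanSpace ℝ d → F) = 0 := by
  funext y
  simp [perSum]

/-- The periodisation is invariant under lattice translations (re-index the lattice sum;
no summability needed). [folklore] -/
theorem perSum_add_latticeVec (g : EuclideanSpace ℝ d → F) (y : EuclideanSpace ℝ d)
    (m : d → ℤ) : perSum g (y + latticeVec m) = perSum g y := by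
  unfold perSum
  rw [← (Equiv.addLeft m).tsum_eq (fun k => g (y + latticeVec k))]
  refine tsum_congr fun k => ?_
  simp only [Equiv.coe_addLeft, latticeVec_add, add_assoc]

/-- The periodisation is lattice periodic. [folklore] -/
theorem isLatticePeriodic_perSum (g : EuclideanSpace ℝ d → F) : IsLatticePeriodic (perSum g) := by
  intro j y
  rw [← latticeVec_single, perSum_add_latticeVec]

/-- The periodisation takes the same value at `y` and at the fundamental-domain representative
of `proj y` (they differ by a lattice vector, `proj_eq_proj_iff_holds`). [folklore] -/
theorem perSum_repr_proj (g : EuclideanSpace ℝ d → F) (y : EuclideanSpace ℝ d) :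
    perSum g (repr (proj y)) = perSum g y := by
  obtain ⟨k, hk⟩ := (proj_eq_proj_iff_holds y (repr (proj y))).1 (proj_repr (proj y)).symm
  rw [hk, perSum_add_latticeVec]

/-- The periodisation read on the torus, `x ↦ perSum g (repr x)`, lifts back to `perSum g`.
[folklore] -/
theorem lift_perSum_comp_repr (g : EuclideanSpace ℝ d → F) :
    lift (fun x => perSum g (repr x)) = perSum g :=
  funext fun y => perSum_repr_proj g y

/-- **Finite-sum formula.** If `g` is supported in the closed ball of radius `R` and `‖y‖ ≤ r`,
the periodisation at `y` is the finite sum over the lattice window of size `n ≥ R + r`. [folklore] -/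
theorem perSum_eq_sum {g : EuclideanSpace ℝ d → F} {R r : ℝ} (hg : support g ⊆ closedBall 0 R)
    {y : EuclideanSpace ℝ d} (hy : ‖y‖ ≤ r) {n : ℕ} (hn : R + r ≤ n) :
    perSum g y = ∑ k ∈ latticeWindow d n, g (y + latticeVec k) :=
  tsum_eq_sum fun _ hk => apply_add_latticeVec_eq_zero hg hy hn hk

/-- Near any point the periodisation of a function with bounded support is a *fixed* finite sum
of translates (window of size `n ≥ R + ‖y₀‖ + 1`, valid on the unit ball around `y₀`). [folklore] -/
theorem perSum_eventuallyEq_sum {g : EuclideanSpace ℝ d → F} {R : ℝ}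
    (hg : support g ⊆ closedBall 0 R) (y₀ : EuclideanSpace ℝ d) {n : ℕ}
    (hn : R + (‖y₀‖ + 1) ≤ n) :
    perSum g =ᶠ[𝓝 y₀] fun y => ∑ k ∈ latticeWindow d n, g (y + latticeVec k) := by
  filter_upwards [ball_mem_nhds y₀ one_pos] with y hy
  refine perSum_eq_sum hg ?_ hn
  have h1 : ‖y - y₀‖ < 1 := by rwa [← dist_eq_norm]
  linarith [norm_le_norm_add_norm_sub' y y₀, norm_sub_rev y₀ y]

/-- On the unit cube the periodisation of a function supported in the closed ball of radius `R`
is the finite sum over the window of size `n ≥ R + card d`. [folklore] -/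
theorem perSum_eq_sum_of_mem_unitCube {g : EuclideanSpace ℝ d → F} {R : ℝ}
    (hg : support g ⊆ closedBall 0 R) {y : EuclideanSpace ℝ d} (hy : y ∈ unitCube d) {n : ℕ}
    (hn : R + Fintype.card d ≤ n) :
    perSum g y = ∑ k ∈ latticeWindow d n, g (y + latticeVec k) :=
  perSum_eq_sum hg (norm_le_card_of_mem_unitCube hy) hn

end PerSum

/-! ## Unfolding of integrals -/

section Unfold

variable [DecidableEq d]

/-- Lebesgue integrals over a lattice translate `k + [0,1)^d` of the unit cube are integrals over
the cube of the translated function (translation invariance of Lebesgue measure). [folklore] -/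
theorem setLIntegral_preimage_sub_latticeVec (G : EuclideanSpace ℝ d → ENNReal) (k : d → ℤ) :
    ∫⁻ y in (fun y => y - latticeVec k) ⁻¹' unitCube d, G y =
      ∫⁻ y in unitCube d, G (y + latticeVec k) := by
  have h := (measurePreserving_sub_right (volume : Measure (EuclideanSpace ℝ d))
    (latticeVec k)).setLIntegral_comp_preimage_emb
    (MeasurableEquiv.subRight (latticeVec k)).measurableEmbedding
    (fun b => G (b + latticeVec k)) (unitCube d)
  simpa only [sub_add_cancel] using h

/-- A finite subadditivity bound: the Lebesgue integral over a finite union of sets is at most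
the sum of the integrals. Generic measure theory: Mathlib has the countable form
`lintegral_iUnion_le` (over a type) and the *disjoint* finite form `lintegral_biUnion_finset`;
the non-disjoint `Finset` form is obtained here by induction from `lintegral_union_le`. [folklore] -/
theorem lintegral_biUnion_finset_le {α ι : Type*} [MeasurableSpace α] (μ : Measure α)
    (s : Finset ι) (t : ι → Set α) (f : α → ENNReal) :
    ∫⁻ a in ⋃ i ∈ s, t i, f a ∂μ ≤ ∑ i ∈ s, ∫⁻ a in t i, f a ∂μ := by
  classical
  induction s using Finset.induction_on with
  | empty => simp
  | insert a s ha ih =>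
    rw [Finset.set_biUnion_insert, Finset.sum_insert ha]
    exact (lintegral_union_le _ _ _).trans (by gcongr)

/-- The Lebesgue integral over a set contained in the closed ball of radius `r` is bounded by the
sum over the lattice window of size `n ≥ r + 1` of the cube integrals of the translates. [folklore] -/
theorem setLIntegral_le_sum_latticeWindow (G : EuclideanSpace ℝ d → ENNReal)
    {B : Set (EuclideanSpace ℝ d)} {r : ℝ} (hB : B ⊆ closedBall 0 r) {n : ℕ} (hn : r + 1 ≤ n) :
    ∫⁻ y in B, G y ≤ ∑ k ∈ latticeWindow d n, ∫⁻ y in unitCube d, G (y + latticeVec k) :=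
  calc ∫⁻ y in B, G y
      ≤ ∫⁻ y in ⋃ k ∈ latticeWindow d n, (fun y => y - latticeVec k) ⁻¹' unitCube d, G y :=
        lintegral_mono_set (hB.trans (closedBall_subset_biUnion_latticeWindow hn))
    _ ≤ ∑ k ∈ latticeWindow d n, ∫⁻ y in (fun y => y - latticeVec k) ⁻¹' unitCube d, G y :=
        lintegral_biUnion_finset_le _ _ _ _
    _ = ∑ k ∈ latticeWindow d n, ∫⁻ y in unitCube d, G (y + latticeVec k) := by
        simp_rw [setLIntegral_preimage_sub_latticeVec]

omit [DecidableEq d] in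
/-- `∫_{[0,1)^d} H ∘ proj = ∫_{T^d} H` for a.e.-measurable `H ≥ 0` (the covering map restricted
to the unit cube is measure preserving, `measurePreserving_proj_unitCube_holds`). [folklore] -/
theorem setLIntegral_unitCube_lift {H : UnitAddTorus d → ENNReal} (hH : AEMeasurable H volume) :
    ∫⁻ y in unitCube d, lift H y = ∫⁻ x, H x := by
  have hmp := measurePreserving_proj_unitCube_holds (d := d)
  have hH' : AEMeasurable H (Measure.map proj (volume.restrict (unitCube d))) := by
    rwa [hmp.map_eq]
  calc ∫⁻ y in unitCube d, lift H y = ∫⁻ y in unitCube d, H (proj y) := rfl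
    _ = ∫⁻ x, H x ∂(Measure.map proj (volume.restrict (unitCube d))) :=
        (lintegral_map' hH' hmp.measurable.aemeasurable).symm
    _ = ∫⁻ x, H x := by rw [hmp.map_eq]

/-- **Local integrability of lifts, Lebesgue form.** For a.e.-measurable `H ≥ 0` on `T^d` and a
set `B ⊆ ℝ^d` inside the closed ball of radius `r`,
`∫_B H ∘ proj ≤ #(window of size n) · ∫_{T^d} H` for `n ≥ r + 1`. [folklore] -/
theorem setLIntegral_lift_le {H : UnitAddTorus d → ENNReal} (hH : AEMeasurable H volume)
    {B : Set (EuclideanSpace ℝ d)} {r : ℝ} (hB : B ⊆ closedBall 0 r) {n : ℕ} (hn : r + 1 ≤ n) :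
    ∫⁻ y in B, lift H y ≤ (latticeWindow d n).card * ∫⁻ x, H x := by
  refine (setLIntegral_le_sum_latticeWindow (lift H) hB hn).trans (le_of_eq ?_)
  have h : ∀ k : d → ℤ, (fun y => lift H (y + latticeVec k)) = lift H := fun k =>
    funext fun y => IsLatticePeriodic.add_latticeVec_holds (isLatticePeriodic_lift H) y k
  simp_rw [h, setLIntegral_unitCube_lift hH, Finset.sum_const, nsmul_eq_mul]

variable [NormedAddCommGroup F]

omit [DecidableEq d] in
/-- **Local integrability of lifts.** If `H` is integrable on `T^d` then `H ∘ proj` is integrable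
on the unit cube. [folklore] -/
theorem integrableOn_unitCube_lift {H : UnitAddTorus d → F} (hH : Integrable H volume) :
    IntegrableOn (lift H) (unitCube d) volume :=
  ((measurePreserving_proj_unitCube_holds (d := d)).integrable_comp hH.aestronglyMeasurable).2 hH

/-- Integrability of the lift of an integrable `H` on every lattice translate of the unit cube
(translation invariance and periodicity of the lift). Spatial twin of
`Torus.measurePreserving_proj_translate` (`TorusSpaceTimeLift`: `proj` is measure preserving
from *any* translate `(· - w) ⁻¹' [0,1)^d` onto `T^d`, which gives this lemma at once; that file
is not imported here to keep the import graph of the periodisation tools light). [folklore] -/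
theorem integrableOn_preimage_sub_latticeVec_lift {H : UnitAddTorus d → F}
    (hH : Integrable H volume) (k : d → ℤ) :
    IntegrableOn (lift H) ((fun y => y - latticeVec k) ⁻¹' unitCube d) volume := by
  have hmp := (measurePreserving_sub_right (volume : Measure (EuclideanSpace ℝ d))
    (latticeVec k)).restrict_preimage (measurableSet_unitCube (d := d))
  have hper : lift H ∘ (fun y => y - latticeVec k) = lift H := by
    funext y
    simp only [comp_apply, sub_eq_add_neg, ← latticeVec_neg] 
    exact IsLatticePeriodic.add_latticeVec_holds (isLatticePeriodic_lift H) y (-k)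
  have h := (hmp.integrable_comp (integrableOn_unitCube_lift hH).aestronglyMeasurable).2
    (integrableOn_unitCube_lift hH)
  rwa [hper] at h

/-- The lift of an integrable function on `T^d` is integrable on every bounded set of `ℝ^d`
(cover it by finitely many lattice translates of the unit cube). [folklore] -/
theorem integrableOn_lift_of_subset_closedBall {H : UnitAddTorus d → F} (hH : Integrable H volume)
    {B : Set (EuclideanSpace ℝ d)} {r : ℝ} (hB : B ⊆ closedBall 0 r) :
    IntegrableOn (lift H) B volume := by
  obtain ⟨n, hn⟩ := exists_nat_ge (r + 1)
  refine IntegrableOn.mono_set ?_ (hB.trans (closedBall_subset_biUnion_latticeWindow hn))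
  exact integrableOn_finset_iUnion.2 fun k _ => integrableOn_preimage_sub_latticeVec_lift hH k

/-- The lift of an integrable function on `T^d` is locally integrable on `ℝ^d`. Spatial twin of
the space–time statement `Torus.locallyIntegrable_stLift` (`TorusSpaceTimeLift`:
`uncurry G ∈ L¹(ℝ × T^d) ⇒ stLift G ∈ L¹_loc(ℝ × ℝ^d)`). [folklore] -/
theorem locallyIntegrable_lift {H : UnitAddTorus d → F} (hH : Integrable H volume) :
    LocallyIntegrable (lift H) volume :=
  locallyIntegrable_iff.2 fun _K hK =>
    let ⟨_r, hr⟩ := hK.isBounded.subset_closedBall 0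
    integrableOn_lift_of_subset_closedBall hH hr

variable [NormedSpace ℝ F]

/-- The cube integrals of the far lattice translates of a boundedly supported function vanish.
[folklore] -/
theorem setIntegral_unitCube_add_latticeVec_eq_zero {g : EuclideanSpace ℝ d → F} {R : ℝ}
    (hg : support g ⊆ closedBall 0 R) {n : ℕ} (hn : R + Fintype.card d ≤ n) {k : d → ℤ}
    (hk : k ∉ latticeWindow d n) : ∫ y in unitCube d, g (y + latticeVec k) = 0 :=
  setIntegral_eq_zero_of_forall_eq_zero fun _ hy =>
    apply_add_latticeVec_eq_zero hg (norm_le_card_of_mem_unitCube hy) hn hk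

/-- **Unfolding.** For an integrable `g` with bounded support,
`∫_{ℝ^d} g = ∫_{[0,1)^d} ∑_{k ∈ ℤ^d} g(y + k) dy` (Stein–Weiss, Ch. VII §2, Thm. 2.4 and its
proof: for `f ∈ L¹(Eₙ)` the periodisation converges in `L¹` of a fundamental domain — there
`Qₙ = [-½, ½)ⁿ`, here `[0,1)^d` — and integrates over it to `∫_{Eₙ} f`, by
`∑_m ∫_{Q} |f(x + m)| dx = ∑_m ∫_{Q - m} |f| = ∫ |f|`; here the sum is finite). [cite: SteinWeiss1971, Ch. VII §2 Thm. 2.4] -/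
theorem integral_eq_setIntegral_unitCube_perSum {g : EuclideanSpace ℝ d → F}
    (hgi : Integrable g volume) {R : ℝ} (hg : support g ⊆ closedBall 0 R) :
    ∫ y, g y = ∫ y in unitCube d, perSum g y := by
  obtain ⟨n, hn⟩ := exists_nat_ge (R + Fintype.card d)
  rw [integral_eq_tsum_setIntegral_unitCube hgi, tsum_eq_sum (s := latticeWindow d n)
    (fun k hk => setIntegral_unitCube_add_latticeVec_eq_zero hg hn hk), ← integral_finsetSum]
  · exact setIntegral_congr_fun measurableSet_unitCube fun y hy =>
      (perSum_eq_sum_of_mem_unitCube hg hy hn).symm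
  · exact fun k _ => (hgi.comp_add_right (latticeVec k)).integrableOn

/-- **Unfolding onto the torus.** For an integrable `g` on `ℝ^d` with bounded support,
`∫_{ℝ^d} g = ∫_{T^d} G`, where `G (x) = ∑_{k ∈ ℤ^d} g (repr x + k)` is the periodisation read on
the torus `Tₙ = Eₙ/Λ` (Stein–Weiss, Ch. VII §2, Thm. 2.4, where `L¹` of a fundamental domain —
there `Qₙ = [-½, ½)ⁿ`, here `[0,1)^d` via `repr` — is identified with `L¹(Tₙ)`). [cite: SteinWeiss1971, Ch. VII §2 Thm. 2.4] -/
theorem integral_eq_integral_perSum_repr {g : EuclideanSpace ℝ d → F} (hgi : Integrable g volume)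
    {R : ℝ} (hg : support g ⊆ closedBall 0 R) :
    ∫ y, g y = ∫ x : UnitAddTorus d, perSum g (repr x) := by
  rw [integral_eq_integral_lift_holds (fun x : UnitAddTorus d => perSum g (repr x)),
    lift_perSum_comp_repr]
  exact integral_eq_setIntegral_unitCube_perSum hgi hg

end Unfold

/-! ## Smoothness of the periodisation of compactly supported smooth functions -/

section Smooth

variable [DecidableEq d] [NormedAddCommGroup F] [NormedSpace ℝ F]

omit [DecidableEq d] in
/-- The Laplacian commutes with translations: `Δ (g(· + a)) (x) = (Δ g)(x + a)`
(Mathlib `iteratedFDeriv_comp_add_right`). Twin of `laplacian_comp_const_add`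
(`FluidPDE/HarmonicMeanValue`, translation on the left, `g (a + ·)`; other layer, not imported
here). [folklore] -/
theorem laplacian_comp_add_right (g : EuclideanSpace ℝ d → F) (a x : EuclideanSpace ℝ d) :
    Δ (fun z => g (z + a)) x = Δ g (x + a) := by
  rw [InnerProductSpace.laplacian_eq_iteratedFDeriv_stdOrthonormalBasis,
    InnerProductSpace.laplacian_eq_iteratedFDeriv_stdOrthonormalBasis]
  simp only [iteratedFDeriv_comp_add_right]

omit [DecidableEq d] in
/-- The Laplacian of a finite sum of `C²` functions is the sum of the Laplacians
(Mathlib `ContDiffAt.laplacian_add`, by induction). Twin of `laplacian_finset_sum_smul`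
(`FluidPDE/NSHopfGalerkinLimit`, sums `∑ᵢ cᵢ • Aᵢ` of smooth torus fields; other layer, not
imported here). [folklore] -/
theorem laplacian_finset_sum {ι : Type*} {s : Finset ι} {A : ι → EuclideanSpace ℝ d → F}
    {x : EuclideanSpace ℝ d} (h : ∀ i ∈ s, ContDiffAt ℝ 2 (A i) x) :
    Δ (fun y => ∑ i ∈ s, A i y) x = ∑ i ∈ s, Δ (A i) x := by
  classical
  induction s using Finset.induction_on with
  | empty => simp
  | insert a s ha ih =>
    have h1 : (fun y => ∑ i ∈ insert a s, A i y) = A a + fun y => ∑ i ∈ s, A i y := by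
      funext y
      rw [Finset.sum_insert ha]
      rfl
    rw [h1, Finset.sum_insert ha, ContDiffAt.laplacian_add (h a (Finset.mem_insert_self a s))
      (ContDiffAt.sum fun i hi => h i (Finset.mem_insert_of_mem hi)),
      ih fun i hi => h i (Finset.mem_insert_of_mem hi)]

omit [DecidableEq d] in
/-- The Laplacian of `g` vanishes outside the topological support of `g`. [folklore] -/
theorem support_laplacian_subset (g : EuclideanSpace ℝ d → F) :
    support (fun x => Δ g x) ⊆ tsupport g := by
  intro x hx
  by_contra h
  have h0 : g =ᶠ[𝓝 x] fun _ => (0 : F) := notMem_tsupport_iff_eventuallyEq.1 h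
  refine hx ?_
  show Δ g x = 0
  rw [(InnerProductSpace.laplacian_congr_nhds h0).self_of_nhds, InnerProductSpace.laplacian_const,
    Pi.zero_apply]

/-- **Smoothness of the periodisation.** The periodisation of a `C^n` function with compact
support (inside the closed ball of radius `R`) is `C^n`: near every point it is a fixed finite
sum of translates (Grafakos, §3.1.1: periodisation maps `C_c^∞(ℝⁿ)` into `C^∞(Tⁿ)`). [folklore] -/
theorem contDiff_perSum {n : WithTop ℕ∞} {g : EuclideanSpace ℝ d → F} (hgs : ContDiff ℝ n g)
    {R : ℝ} (hg : tsupport g ⊆ closedBall 0 R) : ContDiff ℝ n (perSum g) := by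
  refine contDiff_iff_contDiffAt.2 fun y₀ => ?_
  obtain ⟨m, hm⟩ := exists_nat_ge (R + (‖y₀‖ + 1))
  refine ContDiffAt.congr_of_eventuallyEq ?_
    (perSum_eventuallyEq_sum ((subset_tsupport g).trans hg) y₀ hm)
  exact (ContDiff.sum fun k _ => hgs.comp (contDiff_id.add contDiff_const)).contDiffAt

/-- **Derivative of the periodisation**: `D(∑ₖ g(· + k))(y) = ∑ₖ Dg(y + k)` for `C¹` functions
with compact support. [folklore] -/
theorem fderiv_perSum {g : EuclideanSpace ℝ d → F} (hgs : ContDiff ℝ 1 g) {R : ℝ}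
    (hg : tsupport g ⊆ closedBall 0 R) (y : EuclideanSpace ℝ d) :
    _root_.fderiv ℝ (perSum g) y = perSum (fun y => _root_.fderiv ℝ g y) y := by
  obtain ⟨m, hm⟩ := exists_nat_ge (R + (‖y‖ + 1))
  have hd : ∀ k ∈ latticeWindow d m,
      DifferentiableAt ℝ (fun y => g (y + latticeVec k)) y := fun k _ =>
    ((hgs.differentiable one_ne_zero) _).comp y
      ((differentiableAt_id).add (differentiableAt_const _))
  rw [(perSum_eventuallyEq_sum ((subset_tsupport g).trans hg) y hm).fderiv_eq, fderiv_fun_sum hd]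
  simp_rw [fderiv_comp_add_right]
  exact (perSum_eq_sum ((support_fderiv_subset ℝ).trans hg) (by linarith [norm_nonneg y]) hm).symm

/-- **Laplacian of the periodisation**: `Δ(∑ₖ g(· + k))(y) = ∑ₖ (Δg)(y + k)` for `C²` functions
with compact support. [folklore] -/
theorem laplacian_perSum {g : EuclideanSpace ℝ d → F} (hgs : ContDiff ℝ 2 g) {R : ℝ}
    (hg : tsupport g ⊆ closedBall 0 R) (y : EuclideanSpace ℝ d) :
    Δ (perSum g) y = perSum (fun y => Δ g y) y := by
  obtain ⟨m, hm⟩ := exists_nat_ge (R + (‖y‖ + 1))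
  have hc : ∀ k ∈ latticeWindow d m,
      ContDiffAt ℝ 2 (fun y => g (y + latticeVec k)) y := fun k _ =>
    (hgs.comp (contDiff_id.add contDiff_const)).contDiffAt
  rw [(InnerProductSpace.laplacian_congr_nhds
      (perSum_eventuallyEq_sum ((subset_tsupport g).trans hg) y hm)).self_of_nhds,
    laplacian_finset_sum hc]
  simp_rw [laplacian_comp_add_right]
  exact (perSum_eq_sum ((support_laplacian_subset g).trans hg) (by linarith [norm_nonneg y])
    hm).symm

/-- **Gradient of the periodisation** of a `C¹` scalar function with compact support:
`∇(∑ₖ θ(· + k))(y) = ∑ₖ ∇θ(y + k)`. [folklore] -/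
theorem gradient_perSum {θ : EuclideanSpace ℝ d → ℝ} (hθs : ContDiff ℝ 1 θ) {R : ℝ}
    (hθ : tsupport θ ⊆ closedBall 0 R) (y : EuclideanSpace ℝ d) :
    _root_.gradient (perSum θ) y = perSum (fun y => _root_.gradient θ y) y := by
  obtain ⟨m, hm⟩ := exists_nat_ge (R + ‖y‖)
  have hsupp : support (fun y => _root_.gradient θ y) ⊆ closedBall 0 R := by
    intro x hx
    refine (support_fderiv_subset ℝ).trans hθ (mem_support.2 fun h => hx ?_)
    simp [_root_.gradient, h]
  rw [_root_.gradient, fderiv_perSum hθs hθ,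
    perSum_eq_sum ((support_fderiv_subset ℝ).trans hθ) le_rfl hm, perSum_eq_sum hsupp le_rfl hm,
    _root_.map_sum]
  rfl

end Smooth

/-! ## Space–time fields: periodisation in the space variable -/

section SpaceTime

variable [DecidableEq d] [NormedAddCommGroup F] [NormedSpace ℝ F]

omit [DecidableEq d] [NormedSpace ℝ F] in
/-- A space–time field `ψ : ℝ → ℝ^d → F` whose uncurried field has compact support is
supported, uniformly in time, in a fixed closed ball of `ℝ^d`. [folklore] -/
theorem exists_forall_tsupport_subset_closedBall {ψ : ℝ → EuclideanSpace ℝ d → F}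
    (hψ : HasCompactSupport (uncurry ψ)) : ∃ R : ℝ, ∀ t, tsupport (ψ t) ⊆ closedBall 0 R := by
  obtain ⟨R, hR⟩ := (hψ.isCompact.image continuous_snd).isBounded.subset_closedBall 0
  refine ⟨R, fun t => closure_minimal (fun y hy => hR ⟨(t, y), ?_, rfl⟩) isClosed_closedBall⟩
  exact subset_tsupport _ (by simpa [mem_support] using hy)

omit [DecidableEq d] in
/-- If `ψ(·, y)` is supported in the closed ball of radius `R` for every time, then so is any
function of `y` built from the time slice `s ↦ ψ s y` vanishing on the zero path, e.g. the time
derivative `y ↦ d/ds ψ(s, y)|_{s=t}`. [folklore] -/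
theorem support_deriv_slice_subset {ψ : ℝ → EuclideanSpace ℝ d → F} {R : ℝ}
    (hR : ∀ t, tsupport (ψ t) ⊆ closedBall 0 R) (t : ℝ) :
    support (fun y => deriv (fun s => ψ s y) t) ⊆ closedBall 0 R := by
  intro y hy
  by_contra hc
  refine hy ?_
  have h0 : (fun s => ψ s y) = fun _ => 0 :=
    funext fun s => image_eq_zero_of_notMem_tsupport fun h => hc (hR s h)
  simp [h0]

/-- **Joint smoothness of the space-periodised field.** If `(t, y) ↦ ψ t y` is `C^n` on
`ℝ × ℝ^d` and supported in `ℝ × B̄(0, R)`, then `(t, y) ↦ ∑ₖ ψ t (y + k)` is `C^n` (near every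
point it is a fixed finite sum of translates in `y`). [folklore] -/
theorem contDiff_uncurry_perSum {n : WithTop ℕ∞} {ψ : ℝ → EuclideanSpace ℝ d → F}
    (hψ : ContDiff ℝ n (uncurry ψ)) {R : ℝ} (hR : ∀ t, tsupport (ψ t) ⊆ closedBall 0 R) :
    ContDiff ℝ n (uncurry fun t y => perSum (ψ t) y) := by
  refine contDiff_iff_contDiffAt.2 fun p => ?_
  obtain ⟨m, hm⟩ := exists_nat_ge (R + (‖p.2‖ + 1))
  have hev : (uncurry fun t y => perSum (ψ t) y) =ᶠ[𝓝 p]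
      fun q => ∑ k ∈ latticeWindow d m, uncurry ψ (q.1, q.2 + latticeVec k) := by
    have h1 : ∀ᶠ q : ℝ × EuclideanSpace ℝ d in 𝓝 p, dist q.2 p.2 < 1 :=
      (continuous_snd.tendsto p).eventually (ball_mem_nhds p.2 one_pos)
    filter_upwards [h1] with q hq
    refine perSum_eq_sum ((subset_tsupport _).trans (hR q.1)) ?_ hm
    rw [dist_eq_norm] at hq
    linarith [norm_le_norm_add_norm_sub' q.2 p.2, norm_sub_rev q.2 p.2]
  refine ContDiffAt.congr_of_eventuallyEq ?_ hev
  exact (ContDiff.sum fun k _ =>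
    hψ.comp (contDiff_fst.prodMk (contDiff_snd.add contDiff_const))).contDiffAt

/-- **Time derivative of the space-periodised field**:
`∂ₜ (∑ₖ ψ(·, y + k)) (t) = ∑ₖ ∂ₜψ(t, y + k)` for `C¹` fields supported in `ℝ × B̄(0, R)` (at
fixed `y` the lattice sum is a fixed finite sum for all times). [folklore] -/
theorem deriv_perSum {ψ : ℝ → EuclideanSpace ℝ d → F} (hψ : ContDiff ℝ 1 (uncurry ψ)) {R : ℝ}
    (hR : ∀ t, tsupport (ψ t) ⊆ closedBall 0 R) (t : ℝ) (y : EuclideanSpace ℝ d) :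
    deriv (fun s => perSum (ψ s) y) t = perSum (fun y => deriv (fun s => ψ s y) t) y := by
  obtain ⟨m, hm⟩ := exists_nat_ge (R + ‖y‖)
  have h1 : (fun s => perSum (ψ s) y) = fun s => ∑ k ∈ latticeWindow d m, ψ s (y + latticeVec k) :=
    funext fun s => perSum_eq_sum ((subset_tsupport _).trans (hR s)) le_rfl hm
  have hd : ∀ k ∈ latticeWindow d m,
      DifferentiableAt ℝ (fun s => ψ s (y + latticeVec k)) t := fun k _ =>
    ((hψ.differentiable one_ne_zero) _).comp t
      (differentiableAt_id.prodMk (differentiableAt_const _))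
  rw [h1, deriv_fun_sum hd, perSum_eq_sum (support_deriv_slice_subset hR t) le_rfl hm]

end SpaceTime

/-! ## Periodisation onto the torus -/

section Periodize

variable [DecidableEq d]

/-- The **periodisation onto the torus** of a function `g` on `ℝ^d`: the function on `T^d` whose
value at `x` is the lattice sum `∑_{k ∈ ℤ^d} g (repr x + k)` over the fibre of `x`
(Stein–Weiss, Ch. VII §2, (2.1) and §1: functions on `Eₙ/Λ` are identified with periodic
functions on `Eₙ`; Grafakos, §3.1.1). Its lift to `ℝ^d` is `perSum g` (`lift_periodize`).
Generalises the accepted small-support transplant `Torus.transplant ρ z = ρ (reprc z)`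
(`TorusMollifier`), which is this periodisation for `ρ` supported in `B(0, 1/4)` (one non-zero
term in the lattice sum); twin, not imported here. [cite: SteinWeiss1971, Ch. VII §2 (2.1)] -/
def periodize [AddCommMonoid F] [TopologicalSpace F] (g : EuclideanSpace ℝ d → F) :
    UnitAddTorus d → F :=
  fun x => perSum g (repr x)

section Basic

variable [AddCommMonoid F] [TopologicalSpace F]

/-- Unfolding `periodize`. [folklore] -/
theorem periodize_apply (g : EuclideanSpace ℝ d → F) (x : UnitAddTorus d) :
    periodize g x = perSum g (repr x) :=
  rfl

/-- The lift of the torus periodisation is the lattice sum on `ℝ^d`. [folklore] -/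
@[simp]
theorem lift_periodize (g : EuclideanSpace ℝ d → F) : lift (periodize g) = perSum g :=
  lift_perSum_comp_repr g

/-- The torus periodisation evaluated at `proj y` is the lattice sum at `y`. [folklore] -/
@[simp]
theorem periodize_proj (g : EuclideanSpace ℝ d → F) (y : EuclideanSpace ℝ d) :
    periodize g (proj y) = perSum g y :=
  perSum_repr_proj g y

/-- The periodisation of the zero function is zero. [folklore] -/
@[simp]
theorem periodize_zero : periodize (0 : EuclideanSpace ℝ d → F) = 0 := by
  funext x
  simp [periodize]

end Basic

variable [NormedAddCommGroup F] [NormedSpace ℝ F]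

/-- The torus periodisation of a `C^n` function with compact support is `C^n` on `T^d`
(Grafakos, §3.1.1). [folklore] -/
theorem isContDiff_periodize {n : WithTop ℕ∞} {g : EuclideanSpace ℝ d → F} (hgs : ContDiff ℝ n g)
    {R : ℝ} (hg : tsupport g ⊆ closedBall 0 R) : IsContDiff n (periodize g) := by
  unfold IsContDiff
  rw [lift_periodize]
  exact contDiff_perSum hgs hg

/-- The torus periodisation of a smooth function with compact support is smooth on `T^d`
(Grafakos, §3.1.1). [folklore] -/
theorem isSmooth_periodize {g : EuclideanSpace ℝ d → F} (hgs : ContDiff ℝ ∞ g) {R : ℝ}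
    (hg : tsupport g ⊆ closedBall 0 R) : IsSmooth (periodize g) :=
  isContDiff_periodize hgs hg

/-- The torus derivative of the periodisation at `proj y` is the lattice sum of the derivatives:
`D(periodize g)(proj y) = ∑ₖ Dg(y + k)`. [folklore] -/
theorem fderiv_periodize {g : EuclideanSpace ℝ d → F} (hgs : ContDiff ℝ 1 g) {R : ℝ}
    (hg : tsupport g ⊆ closedBall 0 R) (y : EuclideanSpace ℝ d) :
    Torus.fderiv (periodize g) (proj y) = perSum (fun y => _root_.fderiv ℝ g y) y := by
  rw [← fderiv_lift, lift_periodize, fderiv_perSum hgs hg]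

omit [DecidableEq d] in
/-- The torus Laplacian at `proj y` is the Laplacian of the lift at `y` (the two lifts differ by
a translation; twin of `fderiv_lift`). [folklore] -/
theorem laplacian_lift (f : UnitAddTorus d → F) (y : EuclideanSpace ℝ d) :
    Δ (lift f) y = Torus.laplacian f (proj y) := by
  rw [Torus.laplacian, liftAt_proj,
    InnerProductSpace.laplacian_eq_iteratedFDeriv_stdOrthonormalBasis,
    InnerProductSpace.laplacian_eq_iteratedFDeriv_stdOrthonormalBasis]
  simp only [Function.comp_def, iteratedFDeriv_comp_add_left, add_zero]

omit [DecidableEq d] in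
/-- The torus gradient at `proj y` is the gradient of the lift at `y` (from `fderiv_lift`).
[folklore] -/
theorem gradient_lift (θ : UnitAddTorus d → ℝ) (y : EuclideanSpace ℝ d) :
    _root_.gradient (lift θ) y = Torus.gradient θ (proj y) := by
  rw [_root_.gradient, fderiv_lift]
  rfl

/-- The torus Laplacian of the periodisation at `proj y` is the lattice sum of the Laplacians:
`Δ(periodize g)(proj y) = ∑ₖ (Δg)(y + k)`. [folklore] -/
theorem laplacian_periodize {g : EuclideanSpace ℝ d → F} (hgs : ContDiff ℝ 2 g) {R : ℝ}
    (hg : tsupport g ⊆ closedBall 0 R) (y : EuclideanSpace ℝ d) :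
    Torus.laplacian (periodize g) (proj y) = perSum (fun y => Δ g y) y := by
  rw [← laplacian_lift, lift_periodize, laplacian_perSum hgs hg]

/-- The torus gradient of the periodisation of a scalar function at `proj y` is the lattice sum
of the gradients: `∇(periodize θ)(proj y) = ∑ₖ ∇θ(y + k)`. [folklore] -/
theorem gradient_periodize {θ : EuclideanSpace ℝ d → ℝ} (hθs : ContDiff ℝ 1 θ) {R : ℝ}
    (hθ : tsupport θ ⊆ closedBall 0 R) (y : EuclideanSpace ℝ d) :
    Torus.gradient (periodize θ) (proj y) = perSum (fun y => _root_.gradient θ y) y := by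
  rw [← gradient_lift, lift_periodize, gradient_perSum hθs hθ]

/-- `fderiv_periodize` at a point `x` of the torus, through its representative `repr x`.
[folklore] -/
theorem fderiv_periodize' {g : EuclideanSpace ℝ d → F} (hgs : ContDiff ℝ 1 g) {R : ℝ}
    (hg : tsupport g ⊆ closedBall 0 R) (x : UnitAddTorus d) :
    Torus.fderiv (periodize g) x = perSum (fun y => _root_.fderiv ℝ g y) (repr x) := by
  conv_lhs => rw [← proj_repr x]
  exact fderiv_periodize hgs hg (repr x)

/-- `laplacian_periodize` at a point `x` of the torus, through its representative `repr x`.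
[folklore] -/
theorem laplacian_periodize' {g : EuclideanSpace ℝ d → F} (hgs : ContDiff ℝ 2 g) {R : ℝ}
    (hg : tsupport g ⊆ closedBall 0 R) (x : UnitAddTorus d) :
    Torus.laplacian (periodize g) x = perSum (fun y => Δ g y) (repr x) := by
  conv_lhs => rw [← proj_repr x]
  exact laplacian_periodize hgs hg (repr x)

/-- `gradient_periodize` at a point `x` of the torus, through its representative `repr x`.
[folklore] -/
theorem gradient_periodize' {θ : EuclideanSpace ℝ d → ℝ} (hθs : ContDiff ℝ 1 θ) {R : ℝ}
    (hθ : tsupport θ ⊆ closedBall 0 R) (x : UnitAddTorus d) :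
    Torus.gradient (periodize θ) x = perSum (fun y => _root_.gradient θ y) (repr x) := by
  conv_lhs => rw [← proj_repr x]
  exact gradient_periodize hθs hθ (repr x)

omit [NormedSpace ℝ F] in
/-- The space–time lift of the slice-wise periodisation `t ↦ periodize (ψ t)` is the
space-periodised field `(t, y) ↦ ∑ₖ ψ t (y + k)`. [folklore] -/
theorem stLift_periodize (ψ : ℝ → EuclideanSpace ℝ d → F) :
    stLift (fun t => periodize (ψ t)) = uncurry fun t y => perSum (ψ t) y := by
  funext p
  rw [stLift]
  exact periodize_proj (ψ p.1) p.2

/-- The time derivative of the slice-wise periodisation is the periodisation of the time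
derivative: `∂ₜ (periodize ∘ ψ) (t, x) = periodize (∂ₜψ(t, ·)) (x)`. [folklore] -/
theorem timeDeriv_periodize {ψ : ℝ → EuclideanSpace ℝ d → F} (hψ : ContDiff ℝ 1 (uncurry ψ))
    {R : ℝ} (hR : ∀ t, tsupport (ψ t) ⊆ closedBall 0 R) (t : ℝ) (x : UnitAddTorus d) :
    timeDeriv (fun t => periodize (ψ t)) t x =
      periodize (fun y => deriv (fun s => ψ s y) t) x :=
  deriv_perSum hψ hR t (repr x)

end Periodize

end Torus

end Literature.Analysis.FunctionSpaces
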